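import Mathlib
import Summits.Ventures.DiscreteObjects.Mahler.SubLehmerDegree56

/-!
# Scope lemma for non-cyclotomic auxiliary polynomials (venture `DiscreteObjects`, target L, family L6)

Cell `pub-namedobj`, seat `pub-namedobj-mahler` (gen 5). Framing: lottery ticket; floor = certified
bounds/negative ranges.

The explicit auxiliary functions that bound the power sums `s_k(P)` of a candidate polynomial `P`
(census of family L6, degree `56`, sub-Lehmer, height `1`) are sums `σ·Re w + Σ_j c_j log |Q_j(w)|`
evaluated at `w = α^k` over the roots `α` of `P`; the argument needs `Q_j(α^k) ≠ 0` for every root, so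
that the resultant of `∏ (x - α^k)` with `Q_j` is a NONZERO integer.  For cyclotomic `Q_j` this is
"`P` has no cyclotomic factor" (`SubLehmerDegree56.not_cyclotomic_dvd`).  This file proves the purely
field-theoretic scope lemma that admits NON-cyclotomic auxiliary polynomials:

* `aeval_pow_ne_zero_of_natDegree_not_dvd` — if `P, Q ∈ ℤ[x]` are irreducible of positive degree,
  `deg Q ∤ deg P`, and `α` is a root of `P`, then no power `α^k` is a root of `Q`
  (tower law: `[ℚ(α^k):ℚ] = deg Q` would divide `[ℚ(α):ℚ] = deg P`);
* `aux_scope_of_subLehmer` — the degree-56 sub-Lehmer instance (conditional, like everything in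
  `SubLehmerDegree56`, on the named fact `SubLehmerDegreeBound` = [MRW08, Thm 1.1], which makes `P`
  irreducible): every irreducible `Q ∈ ℤ[x]` whose degree does not divide `56` is an admissible
  auxiliary polynomial.

Nothing here asserts any bound on power sums; the certified inequalities themselves are a computation
(cell files `code/mahler5/auxjob56x`, certificates `auxcert_ext_*`), not a Lean theorem.
-/

namespace Summit.Ventures.DiscreteObjects.Mahler

open Polynomial IntermediateField Literature.NumberTheory.MahlerMeasure

/-- **Tower-law scope lemma.** If `P, Q ∈ ℤ[x]` are irreducible of positive degree with
`deg Q ∤ deg P` and `α ∈ ℂ` is a root of `P`, then `Q(α^k) ≠ 0` for every `k`. -/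
theorem aeval_pow_ne_zero_of_natDegree_not_dvd {P Q : ℤ[X]} (hP : Irreducible P)
    (hQ : Irreducible Q) (hPdeg : 0 < P.natDegree) (hQdeg : 0 < Q.natDegree)
    (hndvd : ¬ Q.natDegree ∣ P.natDegree) {α : ℂ} (hα : aeval α P = 0) (k : ℕ) :
    aeval (α ^ k) Q ≠ 0 := by
  intro hQα
  have hinj : Function.Injective (algebraMap ℤ ℚ) := by
    intro a b hab
    exact_mod_cast hab
  -- pass to `ℚ[x]` (Gauss's lemma: irreducible nonconstant integer polynomials are primitive, hence
  -- irreducible over `ℚ`)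
  have hPq : Irreducible (P.map (algebraMap ℤ ℚ)) :=
    ((hP.isPrimitive hPdeg.ne').irreducible_iff_irreducible_map_fraction_map (K := ℚ)).mp hP
  have hQq : Irreducible (Q.map (algebraMap ℤ ℚ)) :=
    ((hQ.isPrimitive hQdeg.ne').irreducible_iff_irreducible_map_fraction_map (K := ℚ)).mp hQ
  have hαP : aeval α (P.map (algebraMap ℤ ℚ)) = 0 := by rwa [aeval_map_algebraMap]
  have hαQ : aeval (α ^ k) (Q.map (algebraMap ℤ ℚ)) = 0 := by rwa [aeval_map_algebraMap]
  -- minimal polynomials and their degrees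
  have hmin1 := minpoly.eq_of_irreducible hPq hαP
  have hmin2 := minpoly.eq_of_irreducible hQq hαQ
  have hlc1 : (P.map (algebraMap ℤ ℚ)).leadingCoeff⁻¹ ≠ 0 :=
    inv_ne_zero (leadingCoeff_ne_zero.mpr hPq.ne_zero)
  have hlc2 : (Q.map (algebraMap ℤ ℚ)).leadingCoeff⁻¹ ≠ 0 :=
    inv_ne_zero (leadingCoeff_ne_zero.mpr hQq.ne_zero)
  have hdeg1 : (minpoly ℚ α).natDegree = P.natDegree := by
    rw [← hmin1, natDegree_mul_C hlc1, natDegree_map_eq_of_injective hinj]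
  have hdeg2 : (minpoly ℚ (α ^ k)).natDegree = Q.natDegree := by
    rw [← hmin2, natDegree_mul_C hlc2, natDegree_map_eq_of_injective hinj]
  -- integrality and the tower `ℚ ⊆ ℚ(α^k) ⊆ ℚ(α)`
  have hαint : IsIntegral ℚ α := isAlgebraic_iff_isIntegral.mp ⟨_, hPq.ne_zero, hαP⟩
  have hαkint : IsIntegral ℚ (α ^ k) := hαint.pow k
  have hle : ℚ⟮α ^ k⟯ ≤ ℚ⟮α⟯ :=
    adjoin_simple_le_iff.mpr (pow_mem (mem_adjoin_simple_self ℚ α) k)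
  have hdvd := finrank_dvd_of_le_right hle
  rw [adjoin.finrank hαkint, adjoin.finrank hαint, hdeg1, hdeg2] at hdvd
  exact hndvd hdvd

/-- **Admissible auxiliary polynomials for family L6.** Conditional on [MRW08, Thm 1.1] (named fact
`SubLehmerDegreeBound`), a sub-Lehmer integer polynomial `P` of degree `56` is irreducible
(`irreducible_of_subLehmer`), so for every irreducible `Q ∈ ℤ[x]` of positive degree NOT dividing `56`
and every root `α` of `P`, no power `α^k` is a root of `Q`: such `Q` may be used in the explicit
auxiliary functions of the census next to the cyclotomic polynomials. -/
theorem aux_scope_of_subLehmer (h : SubLehmerDegreeBound) {P : ℤ[X]} (hdeg : P.natDegree = 56)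
    (hP : SubLehmer P) {Q : ℤ[X]} (hQ : Irreducible Q) (hQdeg : 0 < Q.natDegree)
    (hndvd : ¬ Q.natDegree ∣ 56) {α : ℂ} (hα : aeval α P = 0) (k : ℕ) : aeval (α ^ k) Q ≠ 0 :=
  aeval_pow_ne_zero_of_natDegree_not_dvd (irreducible_of_subLehmer h hdeg hP) hQ (by omega) hQdeg
    (hdeg ▸ hndvd) hα k

end Summit.Ventures.DiscreteObjects.Mahler
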